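import Summits.Ventures.HodgeRepro2.T6B1Carriers
import Summits.Ventures.HodgeRepro2.T5HermitianInertiaSorted

/-!
# `HasSig` is an invariant, and `(p, q)` = (positive, negative) eigenvalue counts (cell pub-hodge-repro2, seat p3)

t6-p4's `T6.B1Carriers.HasSig M p q` (Liu 2021 App. C p. 107 ll. 21–23 «let (p_τ, q_τ) be the signature of
V ⊗_{F,τ} ℝ», read as Sylvester's normal form) is `p + q = n ∧ ∃ P, IsUnit P.det ∧ Pᴴ M P = diag(1^p, (−1)^q)`;
its docstring adds «(p, q) is then the pair (number of positive, number of negative eigenvalues)». Both the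
uniqueness of `(p, q)` and that sentence are THEOREMS here, from T5HermitianInertia (uniqueness) and
T5HermitianInertiaSpectral (the eigenvalue count): `hasSig_unique`, `hasSig_fst_eq_card_pos_eigenvalues`,
`hasSig_snd_eq_card_neg_eigenvalues`, `hasSig_isUnit_det` (a matrix with a signature is invertible), and the existence half
`hasSig_of_isHermitian_of_isUnit_det` (every invertible hermitian matrix has the signature
`(#{λᵢ > 0}, #{λᵢ < 0})`, from T5HermitianInertiaSorted). No display; no device.
§8(d): uses an L-value-free non-vanishing device: NO.
-/

namespace Summit.Ventures.HodgeRepro2.T5HermitianInertiaHasSig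

open Matrix Finset T5HermitianInertia T5HermitianInertiaSpectral T5HermitianInertiaSorted
open Summit.Ventures.HodgeRepro2.T6.B1Carriers (HasSig)

variable {n : ℕ} {M : Matrix (Fin n) (Fin n) ℂ}

/-- The `diag(1^p, (−1)^q)` of `HasSig` is `pmVec n p`. -/
theorem hasSig_iff (p q : ℕ) :
    HasSig M p q ↔ p + q = n ∧ ∃ P : Matrix (Fin n) (Fin n) ℂ, IsUnit P.det ∧
      Pᴴ * M * P = diagonal (pmVec n p) :=
  Iff.rfl

/-- **`HasSig` is an invariant of `M`:** two signatures of the same matrix agree. -/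
theorem hasSig_unique {p q p' q' : ℕ} (h : HasSig M p q) (h' : HasSig M p' q') : p = p' ∧ q = q' := by
  obtain ⟨hn, P, hP, hPM⟩ := h
  obtain ⟨hn', Q, hQ, hQM⟩ := h'
  have hp : p = p' := eq_of_conjTranspose_mul_eq_diagonal_pmVec (by omega) (by omega) hP hQ hPM hQM
  exact ⟨hp, by omega⟩

/-- A matrix with a signature is invertible. -/
theorem hasSig_isUnit_det {p q : ℕ} (h : HasSig M p q) : IsUnit M.det := by
  obtain ⟨-, P, -, hPM⟩ := h
  exact isUnit_det_of_conjTranspose_mul_eq_diagonal (pmVec_mem_pm n p) hPM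

/-- `p` of `HasSig M p q` is the number of positive eigenvalues of the hermitian matrix `M`. -/
theorem hasSig_fst_eq_card_pos_eigenvalues (hM : M.IsHermitian) {p q : ℕ} (h : HasSig M p q) :
    p = (Finset.univ.filter fun i => 0 < hM.eigenvalues i).card := by
  obtain ⟨hn, P, hP, hPM⟩ := h
  exact eq_card_pos_eigenvalues_of_conjTranspose_mul_eq_diagonal_pmVec hM (by omega) hP hPM

/-- `q` of `HasSig M p q` is the number of negative eigenvalues of the hermitian matrix `M`. -/
theorem hasSig_snd_eq_card_neg_eigenvalues (hM : M.IsHermitian) {p q : ℕ} (h : HasSig M p q) :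
    q = (Finset.univ.filter fun i => hM.eigenvalues i < 0).card := by
  obtain ⟨hn, P, hP, hPM⟩ := h
  have h1 := card_neg_one_eq_card_neg_eigenvalues hM hP (pmVec_mem_pm n p) hPM
  have h2 := card_neg_one_add_card_one (pmVec_mem_pm n p)
  rw [card_filter_pmVec_eq_one (by omega), Fintype.card_fin] at h2
  omega

/-- **Existence:** an invertible hermitian matrix has the signature
`(#{positive eigenvalues}, #{negative eigenvalues})`. -/
theorem hasSig_of_isHermitian_of_isUnit_det (hM : M.IsHermitian) (hdet : IsUnit M.det) :
    HasSig M (Finset.univ.filter fun i => 0 < hM.eigenvalues i).card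
      (Finset.univ.filter fun i => hM.eigenvalues i < 0).card :=
  exists_conjTranspose_mul_eq_diagonal_pmVec hM hdet

/-- The signature of an invertible hermitian matrix is exactly `(#{λᵢ > 0}, #{λᵢ < 0})`. -/
theorem hasSig_iff_of_isHermitian (hM : M.IsHermitian) (hdet : IsUnit M.det) (p q : ℕ) :
    HasSig M p q ↔
      p = (Finset.univ.filter fun i => 0 < hM.eigenvalues i).card ∧
        q = (Finset.univ.filter fun i => hM.eigenvalues i < 0).card := by
  constructor
  · intro h
    exact ⟨hasSig_fst_eq_card_pos_eigenvalues hM h, hasSig_snd_eq_card_neg_eigenvalues hM h⟩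
  · rintro ⟨rfl, rfl⟩
    exact hasSig_of_isHermitian_of_isUnit_det hM hdet

end Summit.Ventures.HodgeRepro2.T5HermitianInertiaHasSig
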